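import Mathlib
import HarnessLib
import Summits.ValiantsHypothesis.ValiantsHypothesis.Theorems.LacunarySymmetroidMatrixDescartesProductPlusOneExactZone
import Summits.ValiantsHypothesis.ValiantsHypothesis.Theorems.LacunarySymmetroidMatrixDescartesProductPlusOneNearSwitched

/-!
# ValiantsHypothesis / LacunarySymmetroid — crux `MatrixDescartes` (stmt-ValiantsHypothesis-18050, V1),
# LINE (A) «product_plus_one», floor `OneChangeFloorK3`: the CONFLICT LAW — extra critical points need an in-zone riser AND a far puller

Glue of ✓ `…ExactZone` (bottom weight: a no-dip row is `Ψ`-monotone wherever unswitched or `B_j(x^{q−p}) ≥ 0`) and ✓ `…NearSwitched` (top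
weight: an incoherent row is `T`-monotone wherever nearly switched, `a₀·L_j ≤ 0`).  For a PURE INCOHERENT company (`a_{j0}a_{j1} < 0`,
`a_{j0}a_{j2} < 0`; the floor's `(+,−,−)` rows), `K = 3`, bottom coupling, ANY support:

* ★ `euler_window_roots_le_one_of_nearSwitched` — line currency of the near-switched window law: on a zero-free window `[u,v] ⊂ (0,∞)` on which
  every row is nearly switched at every point (`a_{j0}·((d₂−d₁)a_{j0} + (d₂−d₀)a_{j1}t^{d₁−d₀} + (3(d₂−d₀)−(d₁−d₀))a_{j2}t^{d₂−d₀}) ≤ 0`),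
  `eulerNumerator d a 0` has at most ONE root;
* ★★ `euler_window_roots_le_one_of_noConflict` — THE CONFLICT LAW: if on the zero-free window EITHER every row is, pointwise, unswitched-or-balanced
  (`a_{j2}f_j(t) < 0 ∨ B_j(t) ≥ 0`) OR every row is, pointwise, nearly switched, then at most ONE root.  Contrapositive: a window of a pure
  incoherent company with TWO critical points contains a point where some riser is inside its exact balance zone AND a point where some puller is
  far from its zero — the residual enemy of `OneChangeFloorK3` in kernel form (to be intersected with ✓ few-pullers / ✓ riser-mass).

HONEST FRAMING: glue of landed cells; NOT `OneChangeFloorK3` / the stubs / `MatrixDescartes`; `VP ≠ VNP` is NOT proved.  No definitions, no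
named facts; Mathlib + the lane files.
-/

set_option linter.dupNamespace false

namespace Summit.ValiantsHypothesis.ValiantsHypothesis.Theorems.LacunarySymmetroidMatrixDescartes

namespace ProductPlusOne

open Polynomial Finset
open scoped BigOperators

/-- ★ **NEAR-SWITCHED WINDOW LAW, line currency** (pure incoherent company, ANY support `d 0 < d 1 < d 2`): on a zero-free window
`[u,v] ⊂ (0,∞)` on which every row is nearly switched at every point, `eulerNumerator d a 0` has at most ONE root. [this file's theorem] -/
theorem euler_window_roots_le_one_of_nearSwitched {m : ℕ} (d : Fin 3 → ℕ) (h01 : d 0 < d 1) (h12 : d 1 < d 2)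
    (a : Fin m → Fin 3 → ℝ) (hinc : ∀ j, a j 0 * a j 1 < 0 ∧ a j 0 * a j 2 < 0) {u v : ℝ} (hu : 0 < u)
    (hfree : ∀ t ∈ Set.Icc u v, ∀ j, (∑ l, C (a j l) * X ^ (d l) : ℝ[X]).eval t ≠ 0)
    (hnear : ∀ t ∈ Set.Icc u v, ∀ j, a j 0 * (((d 2 : ℝ) - d 1) * a j 0 + ((d 2 : ℝ) - d 0) * a j 1 * t ^ (d 1 - d 0)
      + (3 * ((d 2 : ℝ) - d 0) - ((d 1 : ℝ) - d 0)) * a j 2 * t ^ (d 2 - d 0)) ≤ 0) :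
    ((∑ j, (∑ l, C (a j l * ((d l : ℝ) - d 0)) * X ^ (d l)) * ∏ i ∈ Finset.univ.erase j, (∑ l, C (a i l) * X ^ (d l))
        : ℝ[X]).roots.toFinset.filter (fun t => u ≤ t ∧ t ≤ v)).card ≤ 1 := by
  classical
  rcases Nat.eq_zero_or_pos m with hm | hm
  · subst hm
    simp only [Finset.univ_eq_empty, Finset.sum_empty, roots_zero, Multiset.toFinset_zero, Finset.filter_empty,
      Finset.card_empty]
    exact Nat.zero_le _
  obtain ⟨e, he⟩ : ∃ e, d 1 = d 0 + e + 1 := ⟨d 1 - d 0 - 1, by omega⟩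
  obtain ⟨k, hk⟩ : ∃ k, d 2 = d 0 + e + k + 2 := ⟨d 2 - d 1 - 1, by omega⟩
  have he1 : d 1 - d 0 = e + 1 := by omega
  have hk2 : d 2 - d 0 = e + k + 2 := by omega
  have hp : ((d 1 : ℝ) - d 0) = (e + 1 : ℝ) := by rw [he]; push_cast; ring
  have hq : ((d 2 : ℝ) - d 0) = (e + k + 2 : ℝ) := by rw [hk]; push_cast; ring
  have hqp : ((d 2 : ℝ) - d 1) = ((k : ℝ) + 1) := by rw [hk, he]; push_cast; ring
  rw [eulerNumerator_eq d e k he hk a 0, sub_self, mul_zero, map_zero, zero_mul, sub_zero]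
  set E : ℝ[X] := X * derivative (∏ j, (C (a j 0) + C (a j 1) * X ^ (e + 1) + C (a j 2) * X ^ (e + k + 2))) with hE
  by_contra hgt
  push Not at hgt
  obtain ⟨z₁, hz₁, z₂, hz₂, hne⟩ := Finset.one_lt_card.mp hgt
  have hc0 : ∀ j, a j 2 ≠ 0 := by
    intro j h0; have := (hinc j).2; rw [h0, mul_zero] at this; exact lt_irrefl 0 this
  have hfree' : ∀ w₁ w₂ : ℝ, u ≤ w₁ → w₂ ≤ v → ∀ t ∈ Set.Icc w₁ w₂, ∀ j,
      a j 0 + a j 1 * t ^ (e + 1) + a j 2 * t ^ (e + k + 2) ≠ 0 := by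
    intro w₁ w₂ hw₁ hw₂ t ht j
    have h := hfree t ⟨hw₁.trans ht.1, ht.2.trans hw₂⟩ j
    rw [eval_row_eq_pow_mul d e k he hk (a j) t] at h
    exact right_ne_zero_of_mul h
  have hrow' : ∀ w₁ w₂ : ℝ, u ≤ w₁ → w₂ ≤ v → ∀ t ∈ Set.Icc w₁ w₂, ∀ j,
      0 < a j 1 * (a j 0 + a j 1 * t ^ (e + 1) + a j 2 * t ^ (e + k + 2)) ∨
      (a j 1 = 0 ∧ a j 2 ≠ 0 ∧ a j 0 + a j 1 * t ^ (e + 1) + a j 2 * t ^ (e + k + 2) ≠ 0) ∨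
      (a j 0 * a j 1 < 0 ∧ a j 2 ≠ 0 ∧ a j 0 * (((k : ℝ) + 1) * a j 0 + (e + k + 2 : ℝ) * a j 1 * t ^ (e + 1)
        + (3 * (e + k + 2 : ℝ) - (e + 1 : ℝ)) * a j 2 * t ^ (e + k + 2)) ≤ 0) := by
    intro w₁ w₂ hw₁ hw₂ t ht j
    have h := hnear t ⟨hw₁.trans ht.1, ht.2.trans hw₂⟩ j
    rw [hp, hq, hqp, he1, hk2] at h
    exact Or.inr (Or.inr ⟨(hinc j).1, hc0 j, h⟩)
  have hmem : ∀ z ∈ (((X : ℝ[X]) ^ (m * d 0) * E).roots.toFinset.filter (fun t => u ≤ t ∧ t ≤ v)),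
      u ≤ z ∧ z ≤ v ∧ eval z E = 0 := by
    intro z hz
    rw [mem_filter, Multiset.mem_toFinset] at hz
    by_cases h0 : (X : ℝ[X]) ^ (m * d 0) * E = 0
    · rw [h0, roots_zero] at hz
      exact absurd hz.1 (Multiset.notMem_zero _)
    · have hr := (mem_roots h0).mp hz.1
      rw [IsRoot.def, eval_mul, eval_pow, eval_X] at hr
      refine ⟨hz.2.1, hz.2.2, ?_⟩
      rcases mul_eq_zero.mp hr with h | h
      · exact absurd h (pow_ne_zero _ (hu.trans_le hz.2.1).ne')
      · exact h
  obtain ⟨hu₁, hv₁, hE₁⟩ := hmem z₁ hz₁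
  obtain ⟨hu₂, hv₂, hE₂⟩ := hmem z₂ hz₂
  rcases lt_or_gt_of_ne hne with hlt | hlt
  · exact X_mul_derivative_no_two_zeros_of_middle' hm (fun j => a j 0) (fun j => a j 1) (fun j => a j 2) e k
      (hu.trans_le hu₁) hlt (hfree' z₁ z₂ hu₁ hv₂) (hrow' z₁ z₂ hu₁ hv₂) hE₁ hE₂
  · exact X_mul_derivative_no_two_zeros_of_middle' hm (fun j => a j 0) (fun j => a j 1) (fun j => a j 2) e k
      (hu.trans_le hu₂) hlt (hfree' z₂ z₁ hu₂ hv₁) (hrow' z₂ z₁ hu₂ hv₁) hE₂ hE₁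

/-- ★★ **THE CONFLICT LAW** (pure incoherent company, `K = 3`, bottom coupling, ANY support `d 0 < d 1 < d 2`): on a zero-free window
`[u,v] ⊂ (0,∞)`, if EITHER (bottom weight) at every point every row is unswitched (`a_{j2}·f_j(t) < 0`) or balanced (`B_j(t) ≥ 0`), OR (top weight)
at every point every row is nearly switched (`a_{j0}·L_j(t) ≤ 0`), then `eulerNumerator d a 0` has at most ONE root there.  A window with two
critical points therefore contains an in-zone riser AND a far puller. [this file's theorem] -/
theorem euler_window_roots_le_one_of_noConflict {m : ℕ} (d : Fin 3 → ℕ) (h01 : d 0 < d 1) (h12 : d 1 < d 2)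
    (a : Fin m → Fin 3 → ℝ) (hinc : ∀ j, a j 0 * a j 1 < 0 ∧ a j 0 * a j 2 < 0) {u v : ℝ} (hu : 0 < u)
    (hfree : ∀ t ∈ Set.Icc u v, ∀ j, (∑ l, C (a j l) * X ^ (d l) : ℝ[X]).eval t ≠ 0)
    (hno : (∀ t ∈ Set.Icc u v, ∀ j,
        a j 2 * (∑ l, C (a j l) * X ^ (d l) : ℝ[X]).eval t < 0 ∨
        0 ≤ ((d 1 : ℝ) - d 0) * ((d 2 : ℝ) - d 0) * a j 2 ^ 2 * (t ^ (d 2 - d 1)) ^ 2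
          - ((d 2 : ℝ) - d 0) * (((d 2 : ℝ) - d 0) - 3 * ((d 1 : ℝ) - d 0)) * (a j 1 * a j 2) * t ^ (d 2 - d 1)
          + ((d 1 : ℝ) - d 0) ^ 2 * a j 1 ^ 2) ∨
      (∀ t ∈ Set.Icc u v, ∀ j, a j 0 * (((d 2 : ℝ) - d 1) * a j 0 + ((d 2 : ℝ) - d 0) * a j 1 * t ^ (d 1 - d 0)
        + (3 * ((d 2 : ℝ) - d 0) - ((d 1 : ℝ) - d 0)) * a j 2 * t ^ (d 2 - d 0)) ≤ 0)) :
    ((∑ j, (∑ l, C (a j l * ((d l : ℝ) - d 0)) * X ^ (d l)) * ∏ i ∈ Finset.univ.erase j, (∑ l, C (a i l) * X ^ (d l))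
        : ℝ[X]).roots.toFinset.filter (fun t => u ≤ t ∧ t ≤ v)).card ≤ 1 := by
  rcases hno with hbot | htop
  · refine euler_window_roots_le_one_of_balance d h01 h12 a hu hfree (fun t ht j => ?_)
    rcases hbot t ht j with h | h
    · exact Or.inl h
    · exact Or.inr ⟨(hinc j).2, h⟩
  · exact euler_window_roots_le_one_of_nearSwitched d h01 h12 a hinc hu hfree htop

end ProductPlusOne

end Summit.ValiantsHypothesis.ValiantsHypothesis.Theorems.LacunarySymmetroidMatrixDescartes
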